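import Mathlib
import Summits.KontsevichZagierPeriods.KontsevichZagierPeriods.Theorems.SoloInformedPellAbelLaw
import Summits.KontsevichZagierPeriods.KontsevichZagierPeriods.Theorems.SoloInformedDecidedHulls
import HarnessLib
import HarnessLib.Audit

/-!
# Kummer family VI: the order-four torsion law for the third kind (s41)

COROLLARY XXIX.6 of the residency paper (§6quindecies), as the first instance of THEOREM XXX
(`SoloInformedPellAbelLaw`).  Along the rational curve `m(s) = 1 − ((s²−1)/2s)⁴`,
`n(s) = 1 − ((s²−1)/2s)²` (`1 < s < 1+√2`: the hyperbolic torsion point of ORDER FOUR of the Kummer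
family, `n = m·sn²(K/4 | m)`), the polynomials `A = (1 + b₂t²)(1 − mt²)`, `B = t(g₁ + g₃t²)` of
`SoloInformedKummerTorsionFourKernel` form a Pell–Abel datum with `R = (1−mt²)(1−nt²)³`
(`soloInformedT4Datum`), whose constant is `α(s) = (s²+2s−1)(3s²+2s+1)/(4(s−1)(s+1)³)`.  Hence

  `⟦Π(n(s) | m(s))⟧ = α(s)·⟦K(m(s))⟧` in `P`, for all representations and all real algebraic `s`,

e.g. `108·Π(5/32 | 175/256) = 119·K(175/256)` (`s = 2`).

References: N. H. Abel (1826); M. Kontsevich, D. Zagier, *Periods* (2001), §1.2; this work.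
-/

noncomputable section

open MeasureTheory Set Filter
open scoped Classical

open Literature.NumberTheory.Transcendental Literature.NumberTheory.Transcendental.KZ
open Literature.ModelTheory.ExponentialFields

namespace Summit.KontsevichZagierPeriods.KontsevichZagierPeriods.Theorems

/-! ### Algebraicity and semialgebraicity of the order-four data -/

/-- `m(s), n(s), b₂(s), g₁(s), g₃(s) ∈ ℚ(s)` are algebraic for algebraic `s`. [folklore] -/
theorem soloInformed_t4_isAlgebraic {s : ℝ} (hsa : IsAlgebraic ℚ s) :
    IsAlgebraic ℚ (soloInformedT4m s) ∧ IsAlgebraic ℚ (soloInformedT4n s) ∧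
      IsAlgebraic ℚ (soloInformedT4b s) ∧ IsAlgebraic ℚ (soloInformedT4g s) ∧
      IsAlgebraic ℚ (soloInformedT4h s) := by
  have hs : s ∈ algebraicClosure ℚ ℝ := mem_algebraicClosure_iff.2 hsa
  have hN : ∀ k : ℕ, (k : ℝ) ∈ algebraicClosure ℚ ℝ := fun k => natCast_mem _ k
  have h2 : (2:ℝ) ∈ algebraicClosure ℚ ℝ := by exact_mod_cast hN 2
  have h3 : (3:ℝ) ∈ algebraicClosure ℚ ℝ := by exact_mod_cast hN 3
  have h4 : (4:ℝ) ∈ algebraicClosure ℚ ℝ := by exact_mod_cast hN 4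
  have h16 : (16:ℝ) ∈ algebraicClosure ℚ ℝ := by exact_mod_cast hN 16
  refine ⟨mem_algebraicClosure_iff.1 ?_, mem_algebraicClosure_iff.1 ?_, mem_algebraicClosure_iff.1 ?_,
    mem_algebraicClosure_iff.1 ?_, mem_algebraicClosure_iff.1 ?_⟩
  · unfold soloInformedT4m; apply_rules (transparency := .reducible) (maxDepth := 250) only
      [pow_mem, div_mem, inv_mem, mul_mem, sub_mem, add_mem, one_mem, hs, h2, h3, h4, h16]
  · unfold soloInformedT4n; apply_rules (transparency := .reducible) (maxDepth := 250) only
      [pow_mem, div_mem, inv_mem, mul_mem, sub_mem, add_mem, one_mem, hs, h2, h3, h4, h16]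
  · unfold soloInformedT4b; apply_rules (transparency := .reducible) (maxDepth := 250) only
      [pow_mem, div_mem, inv_mem, mul_mem, sub_mem, add_mem, one_mem, hs, h2, h3, h4, h16]
  · unfold soloInformedT4g; apply_rules (transparency := .reducible) (maxDepth := 250) only
      [pow_mem, div_mem, inv_mem, mul_mem, sub_mem, add_mem, one_mem, hs, h2, h3, h4, h16]
  · unfold soloInformedT4h; apply_rules (transparency := .reducible) (maxDepth := 250) only
      [pow_mem, div_mem, inv_mem, mul_mem, sub_mem, add_mem, one_mem, hs, h2, h3, h4, h16]

/-- `q(s,t)` and `α(s)` are algebraic for algebraic `s, t`. [folklore] -/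
theorem soloInformed_t4_isAlgebraic' {s t : ℝ} (hsa : IsAlgebraic ℚ s) (hta : IsAlgebraic ℚ t) :
    IsAlgebraic ℚ (soloInformedT4q s t) ∧ IsAlgebraic ℚ (soloInformedT4alpha s) := by
  have hs : s ∈ algebraicClosure ℚ ℝ := mem_algebraicClosure_iff.2 hsa
  have ht : t ∈ algebraicClosure ℚ ℝ := mem_algebraicClosure_iff.2 hta
  have hN : ∀ k : ℕ, (k : ℝ) ∈ algebraicClosure ℚ ℝ := fun k => natCast_mem _ k
  have h2 : (2:ℝ) ∈ algebraicClosure ℚ ℝ := by exact_mod_cast hN 2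
  have h3 : (3:ℝ) ∈ algebraicClosure ℚ ℝ := by exact_mod_cast hN 3
  have h4 : (4:ℝ) ∈ algebraicClosure ℚ ℝ := by exact_mod_cast hN 4
  have h8 : (8:ℝ) ∈ algebraicClosure ℚ ℝ := by exact_mod_cast hN 8
  refine ⟨mem_algebraicClosure_iff.1 ?_, mem_algebraicClosure_iff.1 ?_⟩
  · unfold soloInformedT4q; apply_rules (transparency := .reducible) (maxDepth := 250) only
      [pow_mem, div_mem, inv_mem, mul_mem, sub_mem, add_mem, one_mem, hs, ht, h2, h3, h4, h8]
  · unfold soloInformedT4alpha; apply_rules (transparency := .reducible) (maxDepth := 250) only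
      [pow_mem, div_mem, inv_mem, mul_mem, sub_mem, add_mem, one_mem, hs, ht, h2, h3, h4, h8]

/-- `A(s, wᵢ)`, `B(s, wᵢ)`, `R(s, wᵢ) = (1−mwᵢ²)(1−nwᵢ²)³` are `ℚ`-semialgebraic (algebraic `s`).
[this work] -/
theorem soloInformed_t4_sa {S : Set (Fin 2 → ℝ)} (hS : IsSemialgebraic ℚ S) {s : ℝ}
    (hsa : IsAlgebraic ℚ s) (i : Fin 2) :
    IsSemialgebraicFunOn ℚ S (fun w => soloInformedT4A s (w i)) ∧
    IsSemialgebraicFunOn ℚ S (fun w => soloInformedT4B s (w i)) ∧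
    IsSemialgebraicFunOn ℚ S (fun w => (1 - soloInformedT4m s * w i ^ 2) *
      (1 - soloInformedT4n s * w i ^ 2) ^ 3) := by
  obtain ⟨hm, hn, hb, hg, hh⟩ := soloInformed_t4_isAlgebraic hsa
  have ht : IsSemialgebraicFunOn ℚ S (fun w => w i) := isSemialgebraicFunOn_apply hS i
  have hA1 := SoloInformedPellAbel.sa_quad hS isAlgebraic_one hb i
  have hA2 := SoloInformedPellAbel.sa_quad hS isAlgebraic_one hm.neg i
  have hB1 := SoloInformedPellAbel.sa_quad hS hg hh i
  have hN2 := SoloInformedPellAbel.sa_quad hS isAlgebraic_one hn.neg i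
  refine ⟨(IsSemialgebraicFunOn.mul_holds hA1 hA2).congr fun w _ => ?_,
    (IsSemialgebraicFunOn.mul_holds ht hB1).congr fun w _ => ?_,
    (IsSemialgebraicFunOn.mul_holds hA2
      (IsSemialgebraicFunOn.mul_holds (IsSemialgebraicFunOn.mul_holds hN2 hN2) hN2)).congr
      fun w _ => ?_⟩
  · simp only [Pi.mul_apply, soloInformedT4A]; ring
  · simp only [Pi.mul_apply, soloInformedT4B]
  · simp only [Pi.mul_apply]; ring

/-! ### The order-four Pell–Abel datum -/

/-- `q₂ + nq₀ = (s−1)(s+1)³(s²+1)(s²−2s−1)/(2s⁵) ≠ 0` on the parameter range. [this work] -/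
theorem soloInformed_t4_res {s : ℝ} (hs : 1 < s) (hs' : s ^ 2 < 2 * s + 1) :
    soloInformedT4q s 1 - soloInformedT4q s 0 + soloInformedT4n s * soloInformedT4q s 0 ≠ 0 := by
  have hs0 : s ≠ 0 := by positivity
  have h : soloInformedT4q s 1 - soloInformedT4q s 0 + soloInformedT4n s * soloInformedT4q s 0 =
      (s - 1) * (s + 1) ^ 3 * (s ^ 2 + 1) * (s ^ 2 - 2 * s - 1) / (2 * s ^ 5) := by
    unfold soloInformedT4q soloInformedT4n
    field_simp
    ring
  rw [h]
  refine div_ne_zero (mul_ne_zero (mul_ne_zero (mul_ne_zero ?_ (by positivity)) (by positivity))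
    (by nlinarith)) (by positivity)
  exact sub_ne_zero.2 (ne_of_gt hs)

/-- **The order-four Pell–Abel datum** along `1 < s < 1+√2` (`s` algebraic). [this work] -/
def soloInformedT4Datum (s : ℝ) (hs : 1 < s) (hs' : s ^ 2 < 2 * s + 1) (hsa : IsAlgebraic ℚ s) :
    SoloInformedPellAbel where
  m := soloInformedT4m s
  n := soloInformedT4n s
  q₀ := soloInformedT4q s 0
  q₂ := soloInformedT4q s 1 - soloInformedT4q s 0
  A := soloInformedT4A s
  A' := fun t => soloInformedT4b s * (2 * t) * (1 - soloInformedT4m s * t ^ 2) +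
    (1 + soloInformedT4b s * t ^ 2) * (-(soloInformedT4m s * (2 * t)))
  B := soloInformedT4B s
  B' := fun t => 1 * (soloInformedT4g s + soloInformedT4h s * t ^ 2) + t * (soloInformedT4h s * (2 * t))
  R := fun t => (1 - soloInformedT4m s * t ^ 2) * (1 - soloInformedT4n s * t ^ 2) ^ 3
  m_mem := soloInformed_t4_m_mem hs hs'
  n_mem := soloInformed_t4_n_mem hs hs'
  m_isAlgebraic := (soloInformed_t4_isAlgebraic hsa).1
  n_isAlgebraic := (soloInformed_t4_isAlgebraic hsa).2.1
  q₀_isAlgebraic := (soloInformed_t4_isAlgebraic' hsa isAlgebraic_zero).1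
  q₂_isAlgebraic := ((soloInformed_t4_isAlgebraic' hsa isAlgebraic_one).1).sub
    (soloInformed_t4_isAlgebraic' hsa isAlgebraic_zero).1
  hasDerivAt_A := fun t => by
    show HasDerivAt (fun t => soloInformedT4A s t) _ t
    unfold soloInformedT4A
    exact (((soloInformed_hasDerivAt_sq t).const_mul _).const_add 1).mul
      (((soloInformed_hasDerivAt_sq t).const_mul _).const_sub 1)
  hasDerivAt_B := fun t => by
    show HasDerivAt (fun t => soloInformedT4B s t) _ t
    unfold soloInformedT4B
    exact (hasDerivAt_id' t).mul (((soloInformed_hasDerivAt_sq t).const_mul _).const_add _)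
  continuous_R := by fun_prop
  norm := fun t => by
    have hs0 : s ≠ 0 := by positivity
    rw [soloInformed_t4_norm hs0]
    ring
  num := fun t => by
    have hs0 : s ≠ 0 := by positivity
    have h := soloInformed_t4_numerator hs0 t
    have hq : soloInformedT4q s t =
        soloInformedT4q s 0 + (soloInformedT4q s 1 - soloInformedT4q s 0) * t ^ 2 := by
      unfold soloInformedT4q; ring
    rw [soloInformedT4N, hq] at h
    linear_combination h
  A_pos := fun t ht => (soloInformed_t4_A_pos hs hs' ht).1
  R_pos := fun t ht => by
    have hm := soloInformed_t4_m_mem hs hs'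
    have hn := soloInformed_t4_n_mem hs hs'
    have h1 := mul_le_of_le_one_right hm.1.le ht
    have h2 := mul_le_of_le_one_right hn.1.le ht
    exact mul_pos (by linarith [hm.2]) (pow_pos (by linarith [hn.2]) 3)
  B_zero := by simp [soloInformedT4B]
  res := soloInformed_t4_res hs hs'
  sa_A := fun S hS i => (soloInformed_t4_sa hS hsa i).1
  sa_B := fun S hS i => (soloInformed_t4_sa hS hsa i).2.1
  sa_R := fun S hS i => (soloInformed_t4_sa hS hsa i).2.2

/-- The datum's constant is `α(s)`. [this work] -/
theorem soloInformed_t4_datum_alpha {s : ℝ} (hs : 1 < s) (hs' : s ^ 2 < 2 * s + 1)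
    (hsa : IsAlgebraic ℚ s) : (soloInformedT4Datum s hs hs' hsa).alpha = soloInformedT4alpha s := by
  have hs0 : s ≠ 0 := by positivity
  have hs1 : s - 1 ≠ 0 := sub_ne_zero.2 (ne_of_gt hs)
  have hs2 : s + 1 ≠ 0 := by positivity
  have hw : s ^ 2 - 2 * s - 1 ≠ 0 := by nlinarith
  have hres := soloInformed_t4_res hs hs'
  have h : soloInformedT4q s 1 - soloInformedT4q s 0 + soloInformedT4n s * soloInformedT4q s 0 =
      (s - 1) * (s + 1) ^ 3 * (s ^ 2 + 1) * (s ^ 2 - 2 * s - 1) / (2 * s ^ 5) := by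
    unfold soloInformedT4q soloInformedT4n
    field_simp
    ring
  show (soloInformedT4q s 1 - soloInformedT4q s 0) /
      (soloInformedT4q s 1 - soloInformedT4q s 0 + soloInformedT4n s * soloInformedT4q s 0) =
    soloInformedT4alpha s
  rw [div_eq_iff hres, h]
  unfold soloInformedT4q soloInformedT4alpha
  field_simp
  ring

/-! ### COROLLARY XXIX.6 -/

/-- `α(s)` is algebraic for algebraic `s`. [folklore] -/
theorem soloInformed_t4_alpha_isAlgebraic {s : ℝ} (hsa : IsAlgebraic ℚ s) :
    IsAlgebraic ℚ (soloInformedT4alpha s) :=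
  (soloInformed_t4_isAlgebraic' hsa isAlgebraic_zero).2

/-- **COROLLARY XXIX.6 (order-four torsion law for the third kind).**  For real algebraic `s`
with `1 < s`, `s² < 2s+1`, and `m = m(s)`, `n = n(s)`, `α = α(s)` as above: for ALL representations
`Π_n = [(0,1), κ_m/(1−nx²)]`, `K = [(0,1), κ_m]`, `⟦Π_n⟧ = ⟦[pt, α]⟧·⟦K⟧` in `P`. [this work] -/
theorem soloInformed_kummer_torsionFour (s : ℝ) (hs : 1 < s) (hs' : s ^ 2 < 2 * s + 1)
    (hsa : IsAlgebraic ℚ s) (PN K : IntegralRep 1)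
    (hPNd : PN.domain = {x | x 0 ∈ Ioo (0:ℝ) 1})
    (hPNi : EqOn PN.integrand (fun x => (1 - soloInformedT4n s * x 0 ^ 2)⁻¹ *
      ((√(1 - x 0 ^ 2))⁻¹ * (√(1 - soloInformedT4m s * x 0 ^ 2))⁻¹)) PN.domain)
    (hKd : K.domain = {x | x 0 ∈ Ioo (0:ℝ) 1})
    (hKi : EqOn K.integrand (fun x => (√(1 - x 0 ^ 2))⁻¹ * (√(1 - soloInformedT4m s * x 0 ^ 2))⁻¹)
      K.domain) :
    toFormalPeriod (of PN) =
      toFormalPeriod (of (IntegralRep.unit.constMul (soloInformedT4alpha s)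
        (soloInformed_t4_alpha_isAlgebraic hsa))) * toFormalPeriod (of K) := by
  have h := soloInformed_pellAbel_law (soloInformedT4Datum s hs hs' hsa) PN K hPNd hPNi hKd hKi
  rw [h, soloInformed_pointRep_congr _ (soloInformed_t4_alpha_isAlgebraic hsa)
    (soloInformed_t4_datum_alpha hs hs' hsa)]

/-- **COROLLARY XXIX.6 in values**: `Π(n(s) | m(s)) = α(s)·K(m(s))`. [this work] -/
theorem soloInformed_kummer_torsionFour_value (s : ℝ) (hs : 1 < s) (hs' : s ^ 2 < 2 * s + 1)
    (hsa : IsAlgebraic ℚ s) (PN K : IntegralRep 1)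
    (hPNd : PN.domain = {x | x 0 ∈ Ioo (0:ℝ) 1})
    (hPNi : EqOn PN.integrand (fun x => (1 - soloInformedT4n s * x 0 ^ 2)⁻¹ *
      ((√(1 - x 0 ^ 2))⁻¹ * (√(1 - soloInformedT4m s * x 0 ^ 2))⁻¹)) PN.domain)
    (hKd : K.domain = {x | x 0 ∈ Ioo (0:ℝ) 1})
    (hKi : EqOn K.integrand (fun x => (√(1 - x 0 ^ 2))⁻¹ * (√(1 - soloInformedT4m s * x 0 ^ 2))⁻¹)
      K.domain) :
    PN.value = soloInformedT4alpha s * K.value := by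
  have h := congrArg evalP (soloInformed_kummer_torsionFour s hs hs' hsa PN K hPNd hPNi hKd hKi)
  simpa only [map_mul, evalP_toFormalPeriod_of, IntegralRep.value_constMul,
    IntegralRep.value_unit, mul_one] using h

/-- **The two representations exist**, and satisfy the law. [this work] -/
theorem soloInformed_kummer_torsionFour_exists (s : ℝ) (hs : 1 < s) (hs' : s ^ 2 < 2 * s + 1)
    (hsa : IsAlgebraic ℚ s) :
    ∃ PN K : IntegralRep 1,
      PN.domain = {x | x 0 ∈ Ioo (0:ℝ) 1} ∧
      (∀ x, PN.integrand x = (1 - soloInformedT4n s * x 0 ^ 2)⁻¹ *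
        ((√(1 - x 0 ^ 2))⁻¹ * (√(1 - soloInformedT4m s * x 0 ^ 2))⁻¹)) ∧
      K.domain = {x | x 0 ∈ Ioo (0:ℝ) 1} ∧
      (∀ x, K.integrand x = (√(1 - x 0 ^ 2))⁻¹ * (√(1 - soloInformedT4m s * x 0 ^ 2))⁻¹) ∧
      PN.value = soloInformedT4alpha s * K.value := by
  have hm := soloInformed_t4_m_mem hs hs'
  have hn := soloInformed_t4_n_mem hs hs'
  obtain ⟨hma, hna, -, -, -⟩ := soloInformed_t4_isAlgebraic hsa
  obtain ⟨PN, hPNd, hPNi⟩ := soloInformed_exists_ellipticPi_rep_of_lt_one _ _ hn.2 hna hm hma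
  obtain ⟨K, hKd, hKi⟩ := soloInformed_exists_ellipticK_rep _ hm hma
  exact ⟨PN, K, hPNd, hPNi, hKd, hKi, soloInformed_kummer_torsionFour_value s hs hs' hsa PN K hPNd
    (fun x _ => hPNi x) hKd (fun x _ => hKi x)⟩

/-- **The fibre `s = 2`**: `108·Π(5/32 | 175/256) = 119·K(175/256)` for all representations.
[this work] -/
theorem soloInformed_kummer_torsionFour_two (PN K : IntegralRep 1)
    (hPNd : PN.domain = {x | x 0 ∈ Ioo (0:ℝ) 1})
    (hPNi : EqOn PN.integrand (fun x => (1 - 5 / 32 * x 0 ^ 2)⁻¹ *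
      ((√(1 - x 0 ^ 2))⁻¹ * (√(1 - 175 / 256 * x 0 ^ 2))⁻¹)) PN.domain)
    (hKd : K.domain = {x | x 0 ∈ Ioo (0:ℝ) 1})
    (hKi : EqOn K.integrand (fun x => (√(1 - x 0 ^ 2))⁻¹ * (√(1 - 175 / 256 * x 0 ^ 2))⁻¹)
      K.domain) :
    108 * PN.value = 119 * K.value := by
  have hm : soloInformedT4m 2 = 175 / 256 := by norm_num [soloInformedT4m]
  have hn : soloInformedT4n 2 = 5 / 32 := by norm_num [soloInformedT4n]
  have hα : soloInformedT4alpha 2 = 119 / 108 := by norm_num [soloInformedT4alpha]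
  have h2 : IsAlgebraic ℚ (2:ℝ) := by exact_mod_cast isAlgebraic_nat (R := ℚ) (A := ℝ) 2
  have h := soloInformed_kummer_torsionFour_value 2 (by norm_num) (by norm_num) h2 PN K hPNd
    (by simp only [hm, hn]; exact hPNi) hKd (by simp only [hm]; exact hKi)
  rw [h, hα]
  ring

end Summit.KontsevichZagierPeriods.KontsevichZagierPeriods.Theorems

end
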